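import Literature.MathematicalPhysics.QuantumLattice.KaplanHorschVonDerLindenFieldBound
import Literature.MathematicalPhysics.QuantumLattice.GroundStateSourceBounds
import Literature.MathematicalPhysics.QuantumLattice.FinDimSpectrumProofs
import HarnessLib

/-!
# The Kaplan–Horsch–von der Linden inequality (Koma–Tasaki 1993, Theorem 7.1 / eq. (7.10)) in the
# tree's matrix vocabulary: `Matrix.groundEnergy`, `Matrix.groundStateFunctional`

Seat `hubbard-cq-lit-1` (cell `pub/hubbard-cq`).  Companion of
`KaplanHorschVonDerLindenFieldBound.lean` (abstract inner-product-space form, PROVED there): the same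
printed inequalities — KT93 (7.4)+(7.7)+(7.9) (energy under the field) and (7.10) (order parameter
under the field) — transported along Mathlib's `Matrix.toEuclideanCLM` to Hermitian matrices
`K` ("Hamiltonian") and `O` ("order operator") acting on `n → ℂ`, the vocabulary of the tree's
Hubbard objects (`dWaveSourceTorus`, `DWaveSource.dWaveSourceDensity`, `GroundStateSourceBounds`).
Sources as in the companion file: T. Koma, H. Tasaki, Commun. Math. Phys. **158** (1993) 191–214,
§7, Theorem 7.1 and (7.4)–(7.10) (`KomaTasaki1993`, held as `paper:doi-10-1007-bf02097237`,
pp. 209–210); T. A. Kaplan, P. Horsch, W. von der Linden, J. Phys. Soc. Jpn. **58** (1989) 3894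
(`KaplanHorschVonDerLinden1989`, cite-only `acq-04756`; KT93 §7 reprints theorem and proof).

## Statements (all PROVED; no named facts, no definitions)

For Hermitian `K, O : Matrix n n ℂ`, a normalised ground-state VECTOR `Φ` of `K`
(`K Φ = E₀ Φ`, `E₀ = K.groundEnergy`, `Φ†Φ = 1`) with vanishing odd moments `Φ†OΦ = 0 = Φ†O³Φ`
(KT93 i')) and `OΦ ≠ 0`, write `q := Re (OΦ)†(OΦ) = ⟨Φ, O²Φ⟩ > 0` (the finite-volume long-range
order, `σ_Λ N = √q` in KT93 (7.8)) and `δ := Re (OΦ)†K(OΦ) / q − E₀` (the excitation energy of the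
Horsch–von der Linden state `OΦ/‖OΦ‖`, `= ⟨Φ,[O,[K,O]]Φ⟩/(2q)` by `doubleCommutator_expectation`).
* `kaplanHorschVonDerLinden_groundEnergy_le` (KT93 (7.4) with (7.7), (7.9)): for every real `B`,
  `(K − B·O).groundEnergy ≤ E₀ + δ/2 − B √q` — long-range order forces the ground-state energy under
  the symmetry-breaking field to drop with slope at least `√q`, up to the tower cost `δ/2`;
* `kaplanHorschVonDerLinden_groundStateFunctional_ge` (KT93 (7.10), tracial form): for `B > 0`,
  `Re ω_{K − B·O}(O) ≥ √q − δ/(2B)` for the tracial ground state `Matrix.groundStateFunctional` of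
  `K − B·O` (via the Hellmann–Feynman sandwich `GroundStateSourceBounds.sub_groundEnergy_le_…`:
  `E₀(K) − E₀(K − BO) ≤ B · Re ω_{K−BO}(O)`);
* `doubleCommutator_expectation` (KT93 (7.9) / KT94 (2.9), the identity behind `δ`):
  `(OΦ)†K(OΦ) − E₀ (OΦ)†(OΦ) = ½ Φ†[O,[K,O]]Φ`.
Locality (`‖[O,[K,O]]‖ ≤ 4r²h̄ō²N`, KT94 Thm 2.2) is not assumed here: `δ` is left as the explicit
quotient, to be bounded by the consumer (by `horschVonDerLinden_holds` in the local setting, or by a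
certified number).  Direction: LRO ⟹ response only; see the companion file's header and
`Literature.Barriers.HubbardSuperconductivity.SourcedOrderWithoutGroundStateLRO` for the converse.

## Mathlib / tree search

Bridge lemmas used: `Matrix.toEuclideanCLM_toLp` (rfl), `EuclideanSpace.inner_toLp_toLp`,
`Matrix.isSelfAdjoint_toEuclideanCLM_iff` (tree, `FinDimSpectrumProofs`),
`ContinuousLinearMap.isSelfAdjoint_iff_isSymmetric`, `Matrix.groundEnergy_le_rayleigh_holds` (tree),
`sub_groundEnergy_le_sub_mul_re_groundStateFunctional` (tree, `GroundStateSourceBounds`).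
`lean search 'kaplanHorschVonDerLinden_groundEnergy|doubleCommutator_expectation'`: nothing prior.
-/

noncomputable section

open Complex Matrix WithLp
open scoped InnerProductSpace ComplexConjugate ComplexOrder

namespace Literature.MathematicalPhysics.QuantumLattice.KomaTasaki

variable {n : Type*} [Fintype n]

/-! ### Bridge lemmas `n → ℂ` ↔ `EuclideanSpace ℂ n` -/

/-- `⟨toLp x, toLp y⟩ = x† y`. [folklore] -/
private theorem inner_toLp_eq_star_dotProduct (x y : n → ℂ) :
    ⟪(toLp 2 x : EuclideanSpace ℂ n), toLp 2 y⟫_ℂ = star x ⬝ᵥ y := by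
  rw [EuclideanSpace.inner_toLp_toLp, dotProduct_comm]

/-- A Hermitian matrix acts symmetrically on `EuclideanSpace ℂ n`. [folklore] -/
private theorem toEuclideanCLM_symm [DecidableEq n] {A : Matrix n n ℂ} (hA : A.IsHermitian)
    (φ ψ : EuclideanSpace ℂ n) :
    ⟪toEuclideanCLM (n := n) (𝕜 := ℂ) A φ, ψ⟫_ℂ = ⟪φ, toEuclideanCLM (n := n) (𝕜 := ℂ) A ψ⟫_ℂ := by
  have h := ContinuousLinearMap.isSelfAdjoint_iff_isSymmetric.mp
    ((Matrix.isSelfAdjoint_toEuclideanCLM_iff A).mpr hA)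
  exact h φ ψ

/-- For Hermitian `A`: `(A v)† w = v† (A w)`. [folklore] -/
private theorem star_mulVec_dotProduct {A : Matrix n n ℂ} (hA : A.IsHermitian) (v w : n → ℂ) :
    star (A *ᵥ v) ⬝ᵥ w = star v ⬝ᵥ (A *ᵥ w) := by
  rw [star_mulVec, hA.eq, dotProduct_mulVec]

/-- `‖toLp v‖² = Re v†v`. [folklore] -/
private theorem norm_toLp_sq (v : n → ℂ) :
    ‖(toLp 2 v : EuclideanSpace ℂ n)‖ ^ 2 = (star v ⬝ᵥ v).re := by
  rw [← inner_toLp_eq_star_dotProduct, ← inner_self_eq_norm_sq (𝕜 := ℂ)]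
  rfl

/-- `‖toLp v‖ = √(Re v†v)`. [folklore] -/
private theorem norm_toLp_eq_sqrt (v : n → ℂ) :
    ‖(toLp 2 v : EuclideanSpace ℂ n)‖ = Real.sqrt ((star v ⬝ᵥ v).re) := by
  rw [← norm_toLp_sq, Real.sqrt_sq (norm_nonneg _)]

/-! ### The double-commutator identity (KT93 (7.9), KT94 (2.9)) -/

/-- **The Horsch–von der Linden double-commutator identity in matrix form.**  For Hermitian `K`,
`O` and `K Φ = E₀ Φ` (`E₀` real):
`(OΦ)† K (OΦ) − E₀ · (OΦ)†(OΦ) = ½ · Φ† [O,[K,O]] Φ` with `[O,[K,O]] = O(KO − OK) − (KO − OK)O`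
(KT93 (7.9): "the energy difference can be expressed in terms of a double commutator").
[cite: KomaTasaki1993, §7 (7.9)] [cite: KomaTasaki1994, Theorem 2.2 (2.9)] -/
theorem doubleCommutator_expectation {K O : Matrix n n ℂ} (hK : K.IsHermitian) (hO : O.IsHermitian)
    {Φ : n → ℂ} {E₀ : ℝ} (hKΦ : K *ᵥ Φ = (E₀ : ℂ) • Φ) :
    star (O *ᵥ Φ) ⬝ᵥ (K *ᵥ (O *ᵥ Φ)) - (E₀ : ℂ) * (star (O *ᵥ Φ) ⬝ᵥ (O *ᵥ Φ)) =
      (2 : ℂ)⁻¹ * (star Φ ⬝ᵥ ((O * (K * O - O * K) - (K * O - O * K) * O) *ᵥ Φ)) := by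
  -- expand the double commutator on `Φ`
  have hexp : (O * (K * O - O * K) - (K * O - O * K) * O) *ᵥ Φ =
      O *ᵥ (K *ᵥ (O *ᵥ Φ)) - O *ᵥ (O *ᵥ (K *ᵥ Φ)) - (K *ᵥ (O *ᵥ (O *ᵥ Φ)) - O *ᵥ (K *ᵥ (O *ᵥ Φ))) := by
    simp only [sub_mulVec, ← mulVec_mulVec, mulVec_sub]
  rw [hexp, hKΦ, mulVec_smul, mulVec_smul, dotProduct_sub, dotProduct_sub, dotProduct_sub,
    dotProduct_smul]
  -- move `O` and `K` across the dot products
  have h1 : star Φ ⬝ᵥ (O *ᵥ (K *ᵥ (O *ᵥ Φ))) = star (O *ᵥ Φ) ⬝ᵥ (K *ᵥ (O *ᵥ Φ)) := by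
    rw [star_mulVec_dotProduct hO]
  have h2 : star Φ ⬝ᵥ (O *ᵥ (O *ᵥ Φ)) = star (O *ᵥ Φ) ⬝ᵥ (O *ᵥ Φ) := by
    rw [star_mulVec_dotProduct hO]
  have h3 : star Φ ⬝ᵥ (K *ᵥ (O *ᵥ (O *ᵥ Φ))) = (E₀ : ℂ) * (star (O *ᵥ Φ) ⬝ᵥ (O *ᵥ Φ)) := by
    rw [← star_mulVec_dotProduct hK, hKΦ, star_smul, smul_dotProduct, Complex.star_def,
      Complex.conj_ofReal, smul_eq_mul, h2]
  rw [h1, h2, h3, smul_eq_mul]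
  ring

/-! ### KT93 Theorem 7.1 in matrix form -/

section Main

variable [DecidableEq n]

/-- **KT93 Theorem 7.1, energy form, for matrices (Kaplan–Horsch–von der Linden).**  Let `K`, `O`
be Hermitian, `Φ` a normalised ground-state vector of `K` (`KΦ = E₀Φ`, `E₀ = K.groundEnergy`),
with `Φ†OΦ = 0 = Φ†O³Φ` (KT93 i')) and `OΦ ≠ 0`; put `q = Re (OΦ)†(OΦ) = ⟨Φ,O²Φ⟩` and
`δ = Re (OΦ)†K(OΦ)/q − E₀`.  Then for every real `B`
`(K − B·O).groundEnergy ≤ E₀ + δ/2 − B·√q` (the KHvdL trial state `(Φ + OΦ/√q)/√2` has exactly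
this energy: KT93 (7.4) with (7.7) `(Ψ,OΨ) = √q` and (7.9)).
[cite: KomaTasaki1993, Theorem 7.1, proof (7.4), (7.7), (7.9)] [cite: KaplanHorschVonDerLinden1989, main theorem] -/
theorem kaplanHorschVonDerLinden_groundEnergy_le {K O : Matrix n n ℂ} (hK : K.IsHermitian)
    (hO : O.IsHermitian) {Φ : n → ℂ} (hΦ : star Φ ⬝ᵥ Φ = 1)
    (hKΦ : K *ᵥ Φ = ((K.groundEnergy : ℝ) : ℂ) • Φ)
    (hOΦ : star Φ ⬝ᵥ (O *ᵥ Φ) = 0) (hO3 : star Φ ⬝ᵥ (O *ᵥ (O *ᵥ (O *ᵥ Φ))) = 0)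
    (hne : O *ᵥ Φ ≠ 0) (B : ℝ) :
    (K - (B : ℂ) • O).groundEnergy ≤
      K.groundEnergy +
        ((star (O *ᵥ Φ) ⬝ᵥ (K *ᵥ (O *ᵥ Φ))).re / (star (O *ᵥ Φ) ⬝ᵥ (O *ᵥ Φ)).re
            - K.groundEnergy) / 2 -
        B * Real.sqrt ((star (O *ᵥ Φ) ⬝ᵥ (O *ᵥ Φ)).re) := by
  -- transport to `EuclideanSpace ℂ n`
  set He : EuclideanSpace ℂ n →L[ℂ] EuclideanSpace ℂ n := toEuclideanCLM (n := n) (𝕜 := ℂ) K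
    with hHe
  set Oe : EuclideanSpace ℂ n →L[ℂ] EuclideanSpace ℂ n := toEuclideanCLM (n := n) (𝕜 := ℂ) O
    with hOe
  set Φe : EuclideanSpace ℂ n := toLp 2 Φ with hΦe
  have hHsym : ∀ φ ψ, ⟪He φ, ψ⟫_ℂ = ⟪φ, He ψ⟫_ℂ := toEuclideanCLM_symm hK
  have hOsym : ∀ φ ψ, ⟪Oe φ, ψ⟫_ℂ = ⟪φ, Oe ψ⟫_ℂ := toEuclideanCLM_symm hO
  have hOeΦ : Oe Φe = toLp 2 (O *ᵥ Φ) := toEuclideanCLM_toLp O Φ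
  have hOe2 : Oe (Oe Φe) = toLp 2 (O *ᵥ (O *ᵥ Φ)) := by rw [hOeΦ]; exact toEuclideanCLM_toLp O _
  have hOe3 : Oe (Oe (Oe Φe)) = toLp 2 (O *ᵥ (O *ᵥ (O *ᵥ Φ))) := by
    rw [hOe2]; exact toEuclideanCLM_toLp O _
  have hΦe1 : ‖Φe‖ = 1 := by
    rw [hΦe, norm_toLp_eq_sqrt, hΦ, Complex.one_re, Real.sqrt_one]
  have hHΦe : He Φe = ((K.groundEnergy : ℝ) : ℂ) • Φe := by
    rw [hΦe, hHe, toEuclideanCLM_toLp, hKΦ, toLp_smul]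
  have hOΦe : ⟪Φe, Oe Φe⟫_ℂ = 0 := by rw [hOeΦ, hΦe, inner_toLp_eq_star_dotProduct, hOΦ]
  have hO3e : ⟪Φe, Oe (Oe (Oe Φe))⟫_ℂ = 0 := by
    rw [hOe3, hΦe, inner_toLp_eq_star_dotProduct, hO3]
  have hnee : Oe Φe ≠ 0 := by
    rw [hOeΦ]; exact fun h => hne ((toLp_eq_zero 2).mp h)
  -- the KHvdL state and its energy under `He - B Oe` (companion file)
  have hΨ1 : ‖khvdlState Oe Φe‖ = 1 := norm_khvdlState hΦe1 hOΦe hnee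
  have hfield := re_inner_khvdlState_field hHsym hOsym hΦe1 hHΦe hOΦe hO3e hnee B
  -- variational principle for `K - B O` at the vector `ofLp Ψ`
  have hKB : (K - (B : ℂ) • O).IsHermitian := isHermitian_sub_real_smul hK hO B
  set Ψv : n → ℂ := ofLp (khvdlState Oe Φe) with hΨv
  have hΨtoLp : (toLp 2 Ψv : EuclideanSpace ℂ n) = khvdlState Oe Φe := rfl
  have hΨv1 : star Ψv ⬝ᵥ Ψv = 1 := by
    rw [← inner_toLp_eq_star_dotProduct, hΨtoLp, inner_self_eq_norm_sq_to_K, hΨ1]; norm_num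
  have hvar := Matrix.groundEnergy_le_rayleigh_holds hKB Ψv hΨv1
  -- identify the Rayleigh quotient with `⟨Ψ, (He - B Oe) Ψ⟩`
  have hRay : star Ψv ⬝ᵥ ((K - (B : ℂ) • O) *ᵥ Ψv) =
      ⟪khvdlState Oe Φe, (He - (B : ℂ) • Oe) (khvdlState Oe Φe)⟫_ℂ := by
    rw [← inner_toLp_eq_star_dotProduct, ← toEuclideanCLM_toLp, hΨtoLp, map_sub, map_smul]
  rw [hRay, hfield] at hvar
  -- `Re⟨Ψ', He Ψ'⟩ = Re (OΦ)†K(OΦ) / q` and `‖Oe Φe‖ = √q`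
  have hq : ‖Oe Φe‖ ^ 2 = (star (O *ᵥ Φ) ⬝ᵥ (O *ᵥ Φ)).re := by rw [hOeΦ, norm_toLp_sq]
  have hqpos : 0 < (star (O *ᵥ Φ) ⬝ᵥ (O *ᵥ Φ)).re := by
    rw [← hq]; exact pow_pos (norm_pos_iff.mpr hnee) 2
  have hnormOe : ‖Oe Φe‖ = Real.sqrt ((star (O *ᵥ Φ) ⬝ᵥ (O *ᵥ Φ)).re) := by
    rw [hOeΦ, norm_toLp_eq_sqrt]
  have hΨ' : (⟪hvdlState Oe Φe, He (hvdlState Oe Φe)⟫_ℂ).re =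
      (star (O *ᵥ Φ) ⬝ᵥ (K *ᵥ (O *ᵥ Φ))).re / (star (O *ᵥ Φ) ⬝ᵥ (O *ᵥ Φ)).re := by
    rw [hvdlState_def, map_smul, inner_smul_left, inner_smul_right, map_inv₀, Complex.conj_ofReal,
      ← mul_assoc, ← mul_inv, ← Complex.ofReal_mul, ← sq, hq, hOeΦ, hHe, toEuclideanCLM_toLp,
      inner_toLp_eq_star_dotProduct, ← Complex.ofReal_inv, Complex.re_ofReal_mul]
    rw [div_eq_inv_mul]
  rw [hΨ', hnormOe] at hvar
  linarith

/-- **KT93 Theorem 7.1 / eq. (7.10) for the tracial ground state of `K − B·O` (Kaplan–Horsch–von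
der Linden).**  Same hypotheses, `B > 0`: the sourced one-point function of the uniform mixture of
ground states of `K − B·O` satisfies
`Re ω_{K − B·O}(O) ≥ √q − δ/(2B)`, `q = ⟨Φ,O²Φ⟩`, `δ = Re (OΦ)†K(OΦ)/q − E₀`
(KT93 (7.5): `B (Φ(B), O Φ(B)) ≥ B (Ψ,OΨ) − {(Ψ,HΨ) − E₀}` for every ground state `Φ(B)`, hence for
their uniform mixture; here via the concavity sandwich `E₀(K) − E₀(K−BO) ≤ B · Re ω_{K−BO}(O)` of
`GroundStateSourceBounds`).  Dividing by `N` and bounding `δ ≤ c₀/N` gives the printed (7.10).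
[cite: KomaTasaki1993, Theorem 7.1, (7.5) and (7.10)] [cite: KaplanHorschVonDerLinden1989, main theorem] -/
theorem kaplanHorschVonDerLinden_groundStateFunctional_ge [Nonempty n] {K O : Matrix n n ℂ}
    (hK : K.IsHermitian)
    (hO : O.IsHermitian) {Φ : n → ℂ} (hΦ : star Φ ⬝ᵥ Φ = 1)
    (hKΦ : K *ᵥ Φ = ((K.groundEnergy : ℝ) : ℂ) • Φ)
    (hOΦ : star Φ ⬝ᵥ (O *ᵥ Φ) = 0) (hO3 : star Φ ⬝ᵥ (O *ᵥ (O *ᵥ (O *ᵥ Φ))) = 0)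
    (hne : O *ᵥ Φ ≠ 0) {B : ℝ} (hB : 0 < B) :
    Real.sqrt ((star (O *ᵥ Φ) ⬝ᵥ (O *ᵥ Φ)).re) -
        ((star (O *ᵥ Φ) ⬝ᵥ (K *ᵥ (O *ᵥ Φ))).re / (star (O *ᵥ Φ) ⬝ᵥ (O *ᵥ Φ)).re
            - K.groundEnergy) / (2 * B) ≤
      ((K - (B : ℂ) • O).groundStateFunctional O).re := by
  have hE := kaplanHorschVonDerLinden_groundEnergy_le hK hO hΦ hKΦ hOΦ hO3 hne B
  -- Hellmann–Feynman / concavity: `E₀(K - 0•O) - E₀(K - B•O) ≤ (B - 0) Re ω_{K-BO}(O)`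
  have hHF := sub_groundEnergy_le_sub_mul_re_groundStateFunctional hK hO B 0
  rw [Complex.ofReal_zero, zero_smul, sub_zero, sub_zero] at hHF
  set δ : ℝ := (star (O *ᵥ Φ) ⬝ᵥ (K *ᵥ (O *ᵥ Φ))).re / (star (O *ᵥ Φ) ⬝ᵥ (O *ᵥ Φ)).re
    - K.groundEnergy with hδ
  set s : ℝ := Real.sqrt ((star (O *ᵥ Φ) ⬝ᵥ (O *ᵥ Φ)).re) with hs
  have key : B * s - δ / 2 ≤ B * ((K - (B : ℂ) • O).groundStateFunctional O).re := by linarith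
  have key' : B * (s - δ / (2 * B)) ≤ B * ((K - (B : ℂ) • O).groundStateFunctional O).re := by
    calc B * (s - δ / (2 * B)) = B * s - δ / 2 := by field_simp
      _ ≤ _ := key
  exact le_of_mul_le_mul_left key' hB

end Main

end Literature.MathematicalPhysics.QuantumLattice.KomaTasaki
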